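import Summits.HubbardSuperconductivity.HubbardSuperconductivity.Theorems.NodalWardXYPerturbedXYOrderTwistBound
import Summits.HubbardSuperconductivity.HubbardSuperconductivity.Theorems.NodalWardXYPerturbedXYOrderCharacterSum
import Summits.HubbardSuperconductivity.HubbardSuperconductivity.Theorems.NodalWardXYPerturbedXYOrderRealPlateauEven

/-!
# `PerturbedXYOrder` (stmt-HubbardSuperconductivity-10739) — line `schwarz-inheritance`, stub `stub_twistedJensenBound`

The assembled REAL lower bounds for the O(2)-invariant mean-field source `S = Σ_{x,y} cos(θ_x − θ_y) = |M|²` under the rotator state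
`⟨·⟩_J = ∫_cube · w_J / ∫_cube w_J` on `(ℤ/Lℤ)³` (lead c19; consumed by the negative stub `stub_invariantMeanFieldPinching`,
`Theorems/PerturbedXYOrder/Negative/InvariantMeanFieldPinching.lean`):

* `gp_meanField_lower_pos` — Jensen: `log ⟨e^{σ S/L³}⟩_J ≥ σ L³ Re(cratio L J 0)` (the `K = 0` plateau, `even_re_cratio_zero`);
* `gp_meanField_twist_k` — the symmetrised twisted Jensen bound (`gp_twisted_jensen_symm`) for the axial twist `g_k = 2πk x₀/L`:
  `log ⟨e^{−σ S/L³}⟩_J ≥ −(σ/L³) ⟨Σ_{x,y} cos(θ_x − θ_y) cos(g_k x − g_k y)⟩_J − J Σ_b (1 − cos ∇_b g_k)`;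
* `gp_meanField_lower_neg` — averaged over `k = 1,…,m < L` with the character-sum bound `gp_twistCorr_sum_le` and the cost bound
  `gp_twist_cost_le`: `log ⟨e^{−σ S/L³}⟩_J ≥ −σ L³/m − 2π² m² J L` — the response of the ordered state to the source REVERSES sign
  under a slow twist at cost `O(JL) ≪ L³`, so `s ↦ L⁻³ log ⟨e^{sS/L³}⟩` develops a cusp at `0` as `L → ∞`;
* `stub_twistedJensenBound` (registered stub, skeleton rev 18) — (i) ∧ (ii).
-/

noncomputable section

namespace Summit.HubbardSuperconductivity.HubbardSuperconductivity.Theorems.PerturbedXYOrder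

open MeasureTheory Literature.Probability.LatticeModels Metric Set
open Summit.HubbardSuperconductivity.HubbardSuperconductivity.Theses.NodalWardXY

variable {L : ℕ}

/-- `cos(a + d) + cos(a − d) = 2 cos a cos d`, summed: the symmetrised twisted source is the twisted two-point sum. -/
theorem gp_sum_cos_twist_add [NeZero L] (θ g : TorusSite 3 L → ℝ) :
    (∑ x : TorusSite 3 L, ∑ y : TorusSite 3 L, Real.cos ((θ x + g x) - (θ y + g y))) +
      ∑ x : TorusSite 3 L, ∑ y : TorusSite 3 L, Real.cos ((θ x - g x) - (θ y - g y)) =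
      2 * ∑ x : TorusSite 3 L, ∑ y : TorusSite 3 L, Real.cos (θ x - θ y) * Real.cos (g x - g y) := by
  rw [← Finset.sum_add_distrib, Finset.mul_sum]
  refine Finset.sum_congr rfl fun x _ => ?_
  rw [← Finset.sum_add_distrib, Finset.mul_sum]
  refine Finset.sum_congr rfl fun y _ => ?_
  have e1 : (θ x + g x) - (θ y + g y) = (θ x - θ y) + (g x - g y) := by ring
  have e2 : (θ x - g x) - (θ y - g y) = (θ x - θ y) - (g x - g y) := by ring
  rw [e1, e2, Real.cos_add (θ x - θ y) (g x - g y), Real.cos_sub (θ x - θ y) (g x - g y)]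
  ring

/-- The double cosine sum integrates term by term against the rotator weight. -/
theorem gp_integral_sum_cos_mul [NeZero L] (J : ℝ) :
    ∫ θ in cube L, (∑ x : TorusSite 3 L, ∑ y : TorusSite 3 L, Real.cos (θ x - θ y)) * (wJ J θ).re =
      ∑ x : TorusSite 3 L, ∑ y : TorusSite 3 L, ∫ θ in cube L, Real.cos (θ x - θ y) * (wJ J θ).re := by
  have hwc : Continuous fun θ : TorusSite 3 L → ℝ => (wJ J θ).re := gp_continuous_wJ_re J
  have hxy : ∀ x y : TorusSite 3 L,
      Integrable (fun θ : TorusSite 3 L → ℝ => Real.cos (θ x - θ y) * (wJ J θ).re) (volume.restrict (cube L)) :=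
    fun x y => gp_integrable ((by fun_prop : Continuous fun θ : TorusSite 3 L → ℝ => Real.cos (θ x - θ y)).mul hwc)
  have h1 : ∀ x : TorusSite 3 L, ∑ y : TorusSite 3 L, ∫ θ in cube L, Real.cos (θ x - θ y) * (wJ J θ).re =
      ∫ θ in cube L, ∑ y : TorusSite 3 L, Real.cos (θ x - θ y) * (wJ J θ).re :=
    fun x => (integral_finsetSum _ fun y _ => hxy x y).symm
  simp_rw [h1]
  rw [← integral_finsetSum _ fun x _ => integrable_finsetSum _ fun y _ => hxy x y]
  refine integral_congr_ae (ae_of_all _ fun θ => ?_)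
  simp only [Finset.sum_mul]

/-- **Jensen side**: for the mean-field source `S = Σ_{x,y} cos(θ_x − θ_y)`,
`log ⟨e^{σ S/L³}⟩_J ≥ σ ⟨S⟩_J / L³ = σ L³ Re(cratio L J 0)` (the real plateau). -/
theorem gp_meanField_lower_pos [NeZero L] (J σ : ℝ) :
    σ * (L : ℝ) ^ 3 * (cratio L J (0 : Bond L → Bond L → ℂ)).re ≤
      Real.log ((∫ θ in cube L, Real.exp (σ * ((∑ x : TorusSite 3 L, ∑ y : TorusSite 3 L, Real.cos (θ x - θ y)) /
          (L : ℝ) ^ 3)) * (wJ J θ).re) / ∫ θ in cube L, (wJ J θ).re) := by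
  have hL0 : (0 : ℝ) < L := by have := NeZero.pos L; exact_mod_cast this
  have hZ : 0 < ∫ θ in cube L, (wJ J θ).re := gp_integral_wJ_re_pos J
  have hJ := gp_jensen (L := L) J
    (Ψ := fun θ => σ * ((∑ x : TorusSite 3 L, ∑ y : TorusSite 3 L, Real.cos (θ x - θ y)) / (L : ℝ) ^ 3)) (by fun_prop)
  refine le_trans (le_of_eq ?_) hJ
  -- the left-hand sides agree
  have hre : (cratio L J (0 : Bond L → Bond L → ℂ)).re =
      (∑ x : TorusSite 3 L, ∑ y : TorusSite 3 L, ∫ θ in cube L, Real.cos (θ x - θ y) * (wJ J θ).re) /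
        ((∫ θ in cube L, (wJ J θ).re) * (L : ℝ) ^ 6) := by
    rw [even_re_cratio_zero]; rfl
  have hint : ∫ θ in cube L, σ * ((∑ x : TorusSite 3 L, ∑ y : TorusSite 3 L, Real.cos (θ x - θ y)) / (L : ℝ) ^ 3) *
      (wJ J θ).re = σ / (L : ℝ) ^ 3 *
        ∑ x : TorusSite 3 L, ∑ y : TorusSite 3 L, ∫ θ in cube L, Real.cos (θ x - θ y) * (wJ J θ).re := by
    rw [← gp_integral_sum_cos_mul, ← integral_const_mul]
    refine integral_congr_ae (ae_of_all _ fun θ => ?_)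
    simp only
    ring
  rw [hre, hint]
  field_simp

/-- **Twisted side, one wave number**: for `J ≥ 0` and the axial twist `g_k`,
`log ⟨e^{−σ S/L³}⟩_J ≥ −(σ/L³) ⟨Σ_{x,y} cos(θ_x − θ_y) cos(g_k x − g_k y)⟩_J − J Σ_b (1 − cos ∇_b g_k)`
(`gp_twisted_jensen_symm` with the source `−σS/L³` as a function of the spins). -/
theorem gp_meanField_twist_k [NeZero L] {J : ℝ} (hJ : 0 ≤ J) (σ : ℝ) (k : ℕ) :
    (∫ θ in cube L, (-σ / (L : ℝ) ^ 3 * ∑ x : TorusSite 3 L, ∑ y : TorusSite 3 L, Real.cos (θ x - θ y) *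
        Real.cos (2 * Real.pi * k * ((x 0).val : ℝ) / L - 2 * Real.pi * k * ((y 0).val : ℝ) / L)) * (wJ J θ).re) /
        (∫ θ in cube L, (wJ J θ).re) -
      J * ∑ b : Bond L, (1 - Real.cos (2 * Real.pi * k * (((b.1 + Pi.single b.2 1 : TorusSite 3 L) 0).val : ℝ) / L -
        2 * Real.pi * k * ((b.1 0).val : ℝ) / L)) ≤
      Real.log ((∫ θ in cube L, Real.exp (-σ * ((∑ x : TorusSite 3 L, ∑ y : TorusSite 3 L, Real.cos (θ x - θ y)) /
          (L : ℝ) ^ 3)) * (wJ J θ).re) / ∫ θ in cube L, (wJ J θ).re) := by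
  set F : (TorusSite 3 L → Circle) → ℝ := fun z =>
    -σ * ((∑ x : TorusSite 3 L, ∑ y : TorusSite 3 L, reChar (diffChar y x) z) / (L : ℝ) ^ 3) with hFdef
  have hF : Continuous F := by
    refine continuous_const.mul (Continuous.div_const ?_ _)
    exact continuous_finsetSum _ fun x _ => continuous_finsetSum _ fun y _ => continuous_reChar _
  have h := gp_twisted_jensen_symm (L := L) hJ (fun x : TorusSite 3 L => 2 * Real.pi * k * ((x 0).val : ℝ) / L) hF
  simp only [hFdef, reChar_diffChar_exp] at h
  refine le_trans (le_of_eq ?_) h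
  congr 2
  refine integral_congr_ae (ae_of_all _ fun θ => ?_)
  dsimp only
  have e := gp_sum_cos_twist_add θ (fun x : TorusSite 3 L => 2 * Real.pi * k * ((x 0).val : ℝ) / L)
  rw [show (-σ * ((∑ x : TorusSite 3 L, ∑ y : TorusSite 3 L,
        Real.cos (θ x + 2 * Real.pi * k * ((x 0).val : ℝ) / L - (θ y + 2 * Real.pi * k * ((y 0).val : ℝ) / L))) /
          (L : ℝ) ^ 3) +
      -σ * ((∑ x : TorusSite 3 L, ∑ y : TorusSite 3 L,
        Real.cos (θ x - 2 * Real.pi * k * ((x 0).val : ℝ) / L - (θ y - 2 * Real.pi * k * ((y 0).val : ℝ) / L))) /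
          (L : ℝ) ^ 3)) / 2 =
      -σ / (L : ℝ) ^ 3 * (((∑ x : TorusSite 3 L, ∑ y : TorusSite 3 L,
        Real.cos (θ x + 2 * Real.pi * k * ((x 0).val : ℝ) / L - (θ y + 2 * Real.pi * k * ((y 0).val : ℝ) / L))) +
        ∑ x : TorusSite 3 L, ∑ y : TorusSite 3 L,
          Real.cos (θ x - 2 * Real.pi * k * ((x 0).val : ℝ) / L - (θ y - 2 * Real.pi * k * ((y 0).val : ℝ) / L))) / 2)
      by ring, e]
  ring

/-- **Twisted side**: for `J ≥ 0`, `σ ≥ 0` and `1 ≤ m < L`,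
`log ⟨e^{−σ S/L³}⟩_J ≥ −σ L³/m − 2π² m² J L` (average of `gp_meanField_twist_k` over `k = 1,…,m`: the twisted two-point sums add up to
at most `L⁶`, `gp_twistCorr_sum_le`, and each twist costs at most `2π² m² L`, `gp_twist_cost_le`). -/
theorem gp_meanField_lower_neg [NeZero L] (hL : 2 ≤ L) {J : ℝ} (hJ : 0 ≤ J) {σ : ℝ} (hσ : 0 ≤ σ) {m : ℕ}
    (hm : 1 ≤ m) (hmL : m < L) :
    -(σ * (L : ℝ) ^ 3 / m) - 2 * Real.pi ^ 2 * (m : ℝ) ^ 2 * J * L ≤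
      Real.log ((∫ θ in cube L, Real.exp (-σ * ((∑ x : TorusSite 3 L, ∑ y : TorusSite 3 L, Real.cos (θ x - θ y)) /
          (L : ℝ) ^ 3)) * (wJ J θ).re) / ∫ θ in cube L, (wJ J θ).re) := by
  have hL0 : (0 : ℝ) < L := by have := NeZero.pos L; exact_mod_cast this
  have hm0 : (0 : ℝ) < m := by exact_mod_cast hm
  have hwc : Continuous fun θ : TorusSite 3 L → ℝ => (wJ J θ).re := gp_continuous_wJ_re J
  have hZ : 0 < ∫ θ in cube L, (wJ J θ).re := gp_integral_wJ_re_pos J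
  set Z : ℝ := ∫ θ in cube L, (wJ J θ).re with hZdef
  set R : ℝ := Real.log ((∫ θ in cube L, Real.exp (-σ * ((∑ x : TorusSite 3 L, ∑ y : TorusSite 3 L,
    Real.cos (θ x - θ y)) / (L : ℝ) ^ 3)) * (wJ J θ).re) / Z) with hR
  -- the per-`k` terms
  set V : ℕ → (TorusSite 3 L → ℝ) → ℝ := fun k θ => ∑ x : TorusSite 3 L, ∑ y : TorusSite 3 L, Real.cos (θ x - θ y) *
    Real.cos (2 * Real.pi * k * ((x 0).val : ℝ) / L - 2 * Real.pi * k * ((y 0).val : ℝ) / L) with hV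
  set cost : ℕ → ℝ := fun k => ∑ b : Bond L, (1 - Real.cos (2 * Real.pi * k *
    (((b.1 + Pi.single b.2 1 : TorusSite 3 L) 0).val : ℝ) / L - 2 * Real.pi * k * ((b.1 0).val : ℝ) / L)) with hcost
  have hVc : ∀ k, Continuous (V k) := by intro k; simp only [hV]; fun_prop
  have hk : ∀ k : ℕ, (∫ θ in cube L, (-σ / (L : ℝ) ^ 3 * V k θ) * (wJ J θ).re) / Z - J * cost k ≤ R := by
    intro k
    have h := gp_meanField_twist_k (L := L) hJ σ k
    simp only [hV, hcost, hR, hZdef]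
    exact h
  -- sum over `k = 1, …, m`
  have hsum : ∑ k ∈ Finset.Icc 1 m, ((∫ θ in cube L, (-σ / (L : ℝ) ^ 3 * V k θ) * (wJ J θ).re) / Z - J * cost k) ≤
      ∑ _k ∈ Finset.Icc 1 m, R := Finset.sum_le_sum fun k _ => hk k
  rw [Finset.sum_const, Nat.card_Icc, Nat.add_sub_cancel, nsmul_eq_mul, Finset.sum_sub_distrib,
    ← Finset.mul_sum] at hsum
  -- the twisted two-point sums: `Σ_k ∫ (−σ/L³ V_k) w / Z ≥ −σ L³`
  have hI : ∀ k, Integrable (fun θ => (-σ / (L : ℝ) ^ 3 * V k θ) * (wJ J θ).re) (volume.restrict (cube L)) :=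
    fun k => gp_integrable ((continuous_const.mul (hVc k)).mul hwc)
  have h1 : -(σ * (L : ℝ) ^ 3) ≤ ∑ k ∈ Finset.Icc 1 m, (∫ θ in cube L, (-σ / (L : ℝ) ^ 3 * V k θ) * (wJ J θ).re) / Z := by
    rw [← Finset.sum_div, ← integral_finsetSum _ fun k _ => hI k, le_div_iff₀ hZ]
    have hpt : ∀ θ : TorusSite 3 L → ℝ, -(σ * (L : ℝ) ^ 3) * (wJ J θ).re ≤
        ∑ k ∈ Finset.Icc 1 m, (-σ / (L : ℝ) ^ 3 * V k θ) * (wJ J θ).re := by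
      intro θ
      have hb := gp_twistCorr_sum_le hmL θ
      have hwθ : 0 ≤ (wJ J θ).re := (gp_wJ_re_pos J θ).le
      rw [← Finset.sum_mul, ← Finset.mul_sum]
      refine mul_le_mul_of_nonneg_right ?_ hwθ
      have hVsum : ∑ k ∈ Finset.Icc 1 m, V k θ ≤ ((L : ℝ) ^ 3) ^ 2 := by simpa only [hV] using hb
      have : -σ / (L : ℝ) ^ 3 * ∑ k ∈ Finset.Icc 1 m, V k θ ≥ -σ / (L : ℝ) ^ 3 * ((L : ℝ) ^ 3) ^ 2 :=
        mul_le_mul_of_nonpos_left hVsum (div_nonpos_of_nonpos_of_nonneg (by linarith) (by positivity))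
      calc -(σ * (L : ℝ) ^ 3) = -σ / (L : ℝ) ^ 3 * ((L : ℝ) ^ 3) ^ 2 := by field_simp
        _ ≤ _ := this
    have hIl : Integrable (fun θ => -(σ * (L : ℝ) ^ 3) * (wJ J θ).re) (volume.restrict (cube L)) :=
      (gp_integrable hwc).const_mul _
    have hIr : Integrable (fun θ => ∑ k ∈ Finset.Icc 1 m, (-σ / (L : ℝ) ^ 3 * V k θ) * (wJ J θ).re)
        (volume.restrict (cube L)) := integrable_finsetSum _ fun k _ => hI k
    have := integral_mono hIl hIr hpt
    rw [integral_const_mul] at this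
    exact this
  -- the costs: `J Σ_k cost_k ≤ 2π² m³ J L`
  have h2 : J * ∑ k ∈ Finset.Icc 1 m, cost k ≤ J * (m * (2 * Real.pi ^ 2 * (m : ℝ) ^ 2 * L)) := by
    refine mul_le_mul_of_nonneg_left ?_ hJ
    calc ∑ k ∈ Finset.Icc 1 m, cost k ≤ ∑ _k ∈ Finset.Icc 1 m, 2 * Real.pi ^ 2 * (m : ℝ) ^ 2 * L := by
          refine Finset.sum_le_sum fun k hk' => ?_
          rw [Finset.mem_Icc] at hk'
          exact gp_twist_cost_le hL hk'.2
      _ = m * (2 * Real.pi ^ 2 * (m : ℝ) ^ 2 * L) := by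
          rw [Finset.sum_const, Nat.card_Icc, Nat.add_sub_cancel, nsmul_eq_mul]
  -- combine: `m R ≥ −σL³ − 2π² m³ J L`
  have hmR : -(σ * (L : ℝ) ^ 3) - m * (2 * Real.pi ^ 2 * (m : ℝ) ^ 2 * J * L) ≤ (m : ℝ) * R := by nlinarith
  rw [show -(σ * (L : ℝ) ^ 3 / m) - 2 * Real.pi ^ 2 * (m : ℝ) ^ 2 * J * L =
      (-(σ * (L : ℝ) ^ 3) - m * (2 * Real.pi ^ 2 * (m : ℝ) ^ 2 * J * L)) / m by field_simp]
  rw [div_le_iff₀ hm0]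
  linarith


/-- STUB `stub_twistedJensenBound` (registered on stmt-HubbardSuperconductivity-10739, line `schwarz-inheritance`, rev 18): **twisted Jensen
bounds for the mean-field source** `S = Σ_{x,y} cos(θ_x − θ_y)` under the real rotator state, for `J ≥ 0`, `L ≥ 2`, `σ ≥ 0`, `1 ≤ m < L`:
(i) `log ⟨e^{σS/L³}⟩_J ≥ σ L³ Re(cratio L J 0)` (Jensen); (ii) `log ⟨e^{−σS/L³}⟩_J ≥ −σL³/m − 2π²m²JL` (Gibbs variational principle with
the Mermin–Wagner twists `g_k = 2πk x₀/L`, `k ≤ m`, as trial states; orthogonality of the characters of `ℤ/Lℤ`). [folklore] -/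
theorem stub_twistedJensenBound :
    ∀ (J : ℝ), 0 ≤ J → ∀ (L : ℕ) [NeZero L], 2 ≤ L → ∀ (σ : ℝ), 0 ≤ σ → ∀ (m : ℕ), 1 ≤ m → m < L →
      σ * (L : ℝ) ^ 3 * (cratio L J (0 : Bond L → Bond L → ℂ)).re ≤
          Real.log ((∫ θ in cube L, Real.exp (σ * ((∑ x : TorusSite 3 L, ∑ y : TorusSite 3 L, Real.cos (θ x - θ y)) /
            (L : ℝ) ^ 3)) * (wJ J θ).re) / ∫ θ in cube L, (wJ J θ).re) ∧
        -(σ * (L : ℝ) ^ 3 / m) - 2 * Real.pi ^ 2 * (m : ℝ) ^ 2 * J * L ≤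
          Real.log ((∫ θ in cube L, Real.exp (-σ * ((∑ x : TorusSite 3 L, ∑ y : TorusSite 3 L, Real.cos (θ x - θ y)) /
            (L : ℝ) ^ 3)) * (wJ J θ).re) / ∫ θ in cube L, (wJ J θ).re) :=
  fun J hJ _L _ hL σ hσ _m hm hmL => ⟨gp_meanField_lower_pos J σ, gp_meanField_lower_neg hL hJ hσ hm hmL⟩

end Summit.HubbardSuperconductivity.HubbardSuperconductivity.Theorems.PerturbedXYOrder

end
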